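import Summits.AtomisticToContinuum.HydrodynamicLimit.Theorems.MourreKoopmanChargesLinearToEntropyInBandEnergyCurrentTailsInBand
import Summits.AtomisticToContinuum.HydrodynamicLimit.Theses.BallwiseInvariantReferences
import Summits.AtomisticToContinuum.HydrodynamicLimit.Theses.JaynesSqueeze
import HarnessLib

/-!
# Route `MourreKoopmanCharges`, crux `LinearToEntropyInBand` (stmt-AtomisticToContinuum-17740), line `registered`:
# stub 2 `stub_energyCurrentTailsInBand` — by-name glue onto the TYPED split children of stmt-9235 (wave 3)

Re-audit 2026-08-17 (wave 3).  The shared crux `EnergyCurrentTails` (stmt-AtomisticToContinuum-9235) is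
still OPEN and no landed theorem of `Theorems/` concludes a copy of it unconditionally.  What moved since
wave 2 (`…EnergyCurrentTailsInBand.lean`): the crux was SPLIT (crux-strategist s2, 2026-08-17) and its
open heads are now typed route items with landed route-level glue:

* route `BallwiseInvariantReferences` (rev 4): children
  `FirstPartnerFloorMeso` (stmt-18198, T′), `FirstPartnerRealisedShare` (stmt-18199, I′),
  `EnergyFluxCeilingWindows` (stmt-18200, S2a″), glue
  `BallwiseInvariantReferences.EnergyCurrentTailsGlueBy_holds : T′ → I′ → S2a″ → EnergyCurrentTails`
  (= `QuarticSchurLedger.EnergyCurrentTails_of_firstPartner`);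
* route `JaynesSqueeze` (rev 11): children `QuarticMixingFloorLagged` (stmt-18206, QMF₄ᴸ),
  `EnergyFluxCeilingWindows` (stmt-18207 = stmt-18200 verbatim), glue
  `JaynesSqueeze.EnergyCurrentTailsGlueBy_holds : QMF₄ᴸ → S2a″ → EnergyCurrentTails`
  (= `QuarticSchurLedger.EnergyCurrentTails_of_mixingFloor4L`).

The third head is thereby SHARPER than in wave 2: the bulk bilinear energy-flux ceiling S2a″
(stmt-18200) replaces its typed producer `JeansLoadedDice.ContactIntensityDominationOneRare`
(stmt-16939), which implies it through the landed dock `stub_energyFluxCeilingWindows_of_oneRare`.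
This file records the two sharpened chains BY NAME in the vocabulary of crux 17740; both are registered
glue stubs of stmt-17740 and one-line compositions of the landed route glue with
`LTEInBand.energyCurrentTailsInBand_of_unguarded` (take `η := 1`, ignore the packing guard; the route
copies of `EnergyCurrentTails` are the same `Prop` by `rfl`).  Stub 2 itself stays blocked on
stmt-18198 ∧ stmt-18199 ∧ stmt-18200 (or stmt-18206 ∧ stmt-18207).
-/

noncomputable section

namespace Summit.AtomisticToContinuum.HydrodynamicLimit.Theorems.LTEInBand

open Summit.AtomisticToContinuum.HydrodynamicLimit.Theses

/-- **Registered glue stub `glue_energyCurrentTailsInBand_of_ballwiseSplit`** (crux stmt-17740, line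
`registered`, wave 3 of stub 2): the packing-guarded cubic tails `EnergyCurrentTailsInBand` follow from
the three typed split children of stmt-9235 on route `BallwiseInvariantReferences` — the static
mesoscopic first-partner floor (stmt-18198), the first-partner realised share (stmt-18199) and the bulk
bilinear energy-flux ceiling on all windows (stmt-18200).  Proof:
`energyCurrentTailsInBand_of_unguarded ∘ BallwiseInvariantReferences.EnergyCurrentTailsGlueBy_holds`. -/
theorem glue_energyCurrentTailsInBand_of_ballwiseSplit :
    Summit.AtomisticToContinuum.HydrodynamicLimit.Theses.BallwiseInvariantReferences.FirstPartnerFloorMeso →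
    Summit.AtomisticToContinuum.HydrodynamicLimit.Theses.BallwiseInvariantReferences.FirstPartnerRealisedShare →
    Summit.AtomisticToContinuum.HydrodynamicLimit.Theses.BallwiseInvariantReferences.EnergyFluxCeilingWindows →
    Summit.AtomisticToContinuum.HydrodynamicLimit.Theorems.LTEInBand.EnergyCurrentTailsInBand :=
  fun hT hI hS => energyCurrentTailsInBand_of_unguarded
    (BallwiseInvariantReferences.EnergyCurrentTailsGlueBy_holds hT hI hS)

/-- **Registered glue stub `glue_energyCurrentTailsInBand_of_jaynesSplit`** (crux stmt-17740, line
`registered`, wave 3 of stub 2): the coarser chain through the two typed split children of stmt-9235 on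
route `JaynesSqueeze` — the lagged kinetic-window quartic mixing floor (stmt-18206) and the bulk
bilinear energy-flux ceiling on all windows (stmt-18207, verbatim stmt-18200).  Proof:
`energyCurrentTailsInBand_of_unguarded ∘ JaynesSqueeze.EnergyCurrentTailsGlueBy_holds` (the
`JaynesSqueeze` and `BallwiseInvariantReferences` copies of `EnergyCurrentTails` agree by `rfl`). -/
theorem glue_energyCurrentTailsInBand_of_jaynesSplit :
    Summit.AtomisticToContinuum.HydrodynamicLimit.Theses.JaynesSqueeze.QuarticMixingFloorLagged →
    Summit.AtomisticToContinuum.HydrodynamicLimit.Theses.JaynesSqueeze.EnergyFluxCeilingWindows →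
    Summit.AtomisticToContinuum.HydrodynamicLimit.Theorems.LTEInBand.EnergyCurrentTailsInBand :=
  fun hQ hS => energyCurrentTailsInBand_of_unguarded
    (JaynesSqueeze.EnergyCurrentTailsGlueBy_holds hQ hS)

end Summit.AtomisticToContinuum.HydrodynamicLimit.Theorems.LTEInBand

end
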